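import Mathlib.RingTheory.Ideal.Lattice
import Literature.AlgebraicGeometry.Hu2025.Statements.S06WpEllBlowups.R107aAssociation

/-!
# Hu 2025 (arXiv:2507.21400v1), §6.2.1 (PDF §6b.1): the stages `(kτ)μh` and the order of occurrence of exceptional divisors,
# Def. 6.4 (pre-℘-sets, ℘-sets, ℘-centres), Def. 6.5 (the orders) — file `S06WpEllBlowups/R107bWpSets.lean` (2/3) of
# lit/PARTITION-HU.md row 107, typed by res-type-018 (pre-draft gen 4; T9 re-read + filing gen 5, after the 08:00Z
# re-pointing line). Imports `R107aAssociation` (frame `WpFrame`, divisor names `Div`, tables `AssocB/AssocS`, Def. 6.1–6.3);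
# items ↦ decls and reading notes 1–7: module docstring of file a. Source status and tags as there — UNREFEREED PREPRINT UNDER
# ADJUDICATION; every decl `[claim: Hu2025, status: under-review]` — «STATUS: candidate statement under adjudication
# (D-0012/D-0089); not asserted»; nothing is proved or asserted; AI typing, weaker than expert review.
-/

noncomputable section


namespace Literature.AlgebraicGeometry.Hu2025.Statements.S06WpEllBlowups

universe u v w

namespace WpFrame

variable {P : Type v} {Λ : Type v} [DecidableEq P] [DecidableEq Λ]
variable (W : WpFrame P Λ)

/-! ## The indices `(kτ)μh` and the order of occurrence of exceptional divisors -/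

/-- **The stages of the construction** (C42L181–L188 «induction on the set {(kτ)μ ∣ k ∈ [Υ], τ ∈ [𝔱_{F_k}], μ ∈ [ρ_(kτ)]},
ordered lexicographically»; C44L40–L60 the steps `𝔰_h`; C46L133–L165 and (6.7) C46L157–C47L7, p.105–106: «we let ℓ_k correspond
to one more step after the last step of ℘_k-blowups … Ω = {(11)10} ⊔ ⨆_{k=1}^{Υ} (Index_{Φ_k} ⊔ {ℓ_k}) … {(11)10} < Index_{Φ_k} <
{ℓ_k} < Index_{Φ_{k+1}}»). Typed as a sum: `init` = `(11)10` (the scheme `ℛ̃_ϑ`), `wp ⟨(kτ), μ, h⟩` = the stage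
`(℘_(kτ)𝔯_μ𝔰_h)`, `ellStage k` = `ℓ_k`. Which stages OCCUR (the sets (6.2), (6.7)) is file c's `IndexPhi` / `Omega`.
[claim: Hu2025, status: under-review]
STATUS: candidate statement under adjudication (D-0012/D-0089); not asserted — OURS indexing of printed stages. -/
abbrev Stage (W : WpFrame P Λ) : Type := Unit ⊕ (Fin W.N × ℕ × ℕ × ℕ) ⊕ Fin W.N

namespace Stage

variable {W}

/-- the initial stage `(11)10` = `ℛ̃_ϑ` (C46L158, C47L... «(11)10 is the smallest element», C48L62).
[claim: Hu2025, status: under-review]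
STATUS: candidate statement under adjudication (D-0012/D-0089); not asserted. -/
def init : W.Stage := Sum.inl ()

/-- the stage `(℘_(kτ)𝔯_μ𝔰_h)` (block `k : Fin Υ`; PRINTED naturals `τ, μ, h`; C44L52–L55 «ℛ̃_{(℘_(kτ)𝔯_μ𝔰_0)} :=
ℛ̃_{(℘_(kτ)𝔯_{μ−1})}», C43L12–L15 «(℘_(kτ)𝔯_0) := (℘_(k(τ−1))𝔯_{ρ_(k(τ−1))}) … (℘_(k1)𝔯_0) := (℘_((k−1)𝔱_{F_{k−1}})𝔯_{ρ})» are
identifications of stages with `h = 0` resp. `μ = 0`, recorded here, not quotiented).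
[claim: Hu2025, status: under-review]
STATUS: candidate statement under adjudication (D-0012/D-0089); not asserted. -/
def wp (k : Fin W.N) (τ μ h : ℕ) : W.Stage := Sum.inr (Sum.inl (k, τ, μ, h))

/-- the stage `ℓ_k` (the ℓ_k-blow-up).
[claim: Hu2025, status: under-review]
STATUS: candidate statement under adjudication (D-0012/D-0089); not asserted. -/
def ellStage (k : Fin W.N) : W.Stage := Sum.inr (Sum.inr k)

/-- Lexicographic comparison of the printed multi-indices `(kτ)μh` (C42L185 «ordered lexicographically on (k,τ,μ)»; C47L6–L7
«this order also coincides with the lexicographical order on {(kτ)μh}»), as lists of naturals. Plumbing.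
[claim: Hu2025, status: under-review]
STATUS: candidate statement under adjudication (D-0012/D-0089); not asserted. -/
def key (x : Fin W.N × ℕ × ℕ × ℕ) : List ℕ := [x.1.val, x.2.1, x.2.2.1, x.2.2.2]

/-- **The linear order on the stages** ((6.7) and C46L166–C47L7, p.106: «{(11)10} < Index_{Φ_k} < {ℓ_k} < Index_{Φ_{k+1}} for
all k ∈ [Υ−1] … the set Ω … is totally ordered. Furthermore, this order also coincides with the lexicographical order on
{(kτ)μh}»): `init` first; ℘-stages lexicographically in `(k,τ,μ,h)`; `ℓ_k` after every ℘-stage of the blocks `≤ k` and before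
those of the blocks `> k`; `ℓ_k < ℓ_{k'}` iff `k < k'`.
[claim: Hu2025, status: under-review]
STATUS: candidate statement under adjudication (D-0012/D-0089); not asserted. -/
def LT (a b : W.Stage) : Prop :=
  Sum.elim
    (fun _ => Sum.elim (fun _ => False) (fun _ => True) b)
    (fun a' => Sum.elim
      (fun x => Sum.elim (fun _ => False)
        (fun b' => Sum.elim (fun y => List.Lex (· < ·) (key x) (key y)) (fun k' => x.1 ≤ k') b') b)
      (fun k => Sum.elim (fun _ => False)
        (fun b' => Sum.elim (fun y => k < y.1) (fun k' => k < k') b') b)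
      a')
    a

end Stage

namespace Div

variable {W}

/-- **The stage at which an exceptional divisor is CREATED** («order of occurrence», Def. 6.5 C44L4–L5, C44L13–L14, C45L1–L4):
`E_{ϑ,k}` at the initial stage (created by the ϑ-blow-ups, in the order `k = 1, …, Υ` — compared among themselves by `k`),
`E_{·,(kτ)μh}` at `(℘_(kτ)𝔯_μ𝔰_h)`, `E_{ℓ_k}` at `ℓ_k`; `none` for non-exceptional names.
[claim: Hu2025, status: under-review]
STATUS: candidate statement under adjudication (D-0012/D-0089); not asserted — OURS bookkeeping. -/
def birth (Y : W.Div) : Option W.Stage :=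
  Div.cases (fun _ => none) (fun _ => none) (fun _ => none) (fun _ => some Stage.init)
    (fun x => some (Stage.wp x.1 x.2.1 x.2.2.1 x.2.2.2)) (fun k => some (Stage.ellStage k)) Y

/-- **«order of occurrence» of exceptional divisors** (Def. 6.5 C44L4–L5 «We order them by reversing the order of occurrence
of the exceptional divisors»; C45L1–L4 «E_{…,(kτ)μh''} ≤ E_{…,(kτ)μh'} if h'' ≥ h'»): `Y` occurred strictly before `Y'`. Among
the ϑ-exceptional divisors the order of the ϑ-blow-ups `ϑ_[1], …, ϑ_[Υ]` (Def. 5.9, row 106) is used.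
[claim: Hu2025, status: under-review]
STATUS: candidate statement under adjudication (D-0012/D-0089); not asserted. -/
def OccLT (Y Y' : W.Div) : Prop :=
  ∃ a b, Y.birth = some a ∧ Y'.birth = some b ∧
    (Stage.LT a b ∨ (a = Stage.init ∧ b = Stage.init ∧
      ∃ j j' : Fin W.N, Y = excTheta j ∧ Y' = excTheta j' ∧ j < j'))

end Div

/-! ## Def. 6.4 — pre-℘-sets, ℘-sets, ℘-centres -/

/-- **Definition 6.4, first part (C43L92–L108; p.99): a pre-℘-set in `(℘_(kτ)𝔯_μ)`.** «A pre-℘-set ϕ in (℘_(kτ)𝔯_μ), written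
as ϕ = {Y⁺, Y⁻}, consists of exactly two divisors of the scheme ℛ̃_{(℘_(kτ)𝔯_{μ−1})} such that Y^± is associated with T^±_(kτ).
Given the above pre-℘-set ϕ, we let Z_ϕ = Y⁺ ∩ Y⁻ be the scheme-theoretic intersection.» Typed over the set `𝒟` of divisor
names of `ℛ̃_{(℘_(kτ)𝔯_{μ−1})}` (file c `divsBefore`) and the column `m Y i = m_{Y,T^i_(kτ)}` of the current multiplicity table:
an ORDERED pair `(Y⁺, Y⁻)` of members of `𝒟`, `Y⁺` associated with `T⁺` (`i = 0`), `Y⁻` with `T⁻` (`i = 1`), and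
`Y⁺ ≠ Y⁻` («exactly two divisors», reading note 5). `Z_ϕ` on a chart: `wpCentreIdeal`.
[claim: Hu2025, status: under-review]
STATUS: candidate statement under adjudication (D-0012/D-0089); not asserted. -/
structure _root_.Literature.AlgebraicGeometry.Hu2025.Statements.S06WpEllBlowups.PreWpSet (W : WpFrame P Λ) (𝒟 : Set W.Div) (m : W.Div → Fin 2 → ℕ) where
  /-- `Y⁺` -/
  plus : W.Div
  /-- `Y⁻` -/
  minus : W.Div
  /-- `Y⁺` is a divisor of `ℛ̃_{(℘_(kτ)𝔯_{μ−1})}` -/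
  plus_mem : plus ∈ 𝒟
  /-- `Y⁻` is a divisor of `ℛ̃_{(℘_(kτ)𝔯_{μ−1})}` -/
  minus_mem : minus ∈ 𝒟
  /-- «Y⁺ is associated with T⁺_(kτ)» -/
  plus_assoc : IsAssociated (m plus 0)
  /-- «Y⁻ is associated with T⁻_(kτ)» -/
  minus_assoc : IsAssociated (m minus 1)
  /-- «consists of exactly two divisors» -/
  plus_ne_minus : plus ≠ minus

/-- **Definition 6.4, second part (C43L110–L114; p.99): ℘-sets / ℘-centres.** «The pre-℘-set ϕ (resp. Z_ϕ) is called a ℘-set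
(resp. ℘-center) in (℘_(kτ)𝔯_μ) if Z_ϕ ∩ Ṽ_{(℘_(kτ)𝔯_{μ−1})} ≠ ∅. In such a case, we also call ϕ (resp. Z_ϕ) a ℘_k-set (resp.
℘_k-center).» The TEST «Y⁺ ∩ Y⁻ ∩ Ṽ_{(℘_(kτ)𝔯_{μ−1})} ≠ ∅» is the explicit parameter `meetsV` (a relation on divisor names, supplied
by the scheme/chart level — chart reading `meetsOnChart`; it is where the base field 𝔽 enters, PARTITION-HU §6 (c)).
PARTITION name `IsWpSet` = `Def6_4`.
[claim: Hu2025, status: under-review]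
STATUS: candidate statement under adjudication (D-0012/D-0089); not asserted. -/
def _root_.Literature.AlgebraicGeometry.Hu2025.Statements.S06WpEllBlowups.IsWpSet (W : WpFrame P Λ) {𝒟 : Set W.Div} {m : W.Div → Fin 2 → ℕ} (meetsV : W.Div → W.Div → Prop) (φ : PreWpSet W 𝒟 m) : Prop :=
  meetsV φ.plus φ.minus

/-- **Definition 6.4 under its printed name** (`Def6_4 W meetsV φ` = «the pre-℘-set `φ` is a ℘-set», C43L110–L114). Alias of
`IsWpSet`.
[claim: Hu2025, status: under-review]
STATUS: candidate statement under adjudication (D-0012/D-0089); not asserted. -/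
abbrev _root_.Literature.AlgebraicGeometry.Hu2025.Statements.S06WpEllBlowups.Def6_4 (W : WpFrame P Λ) {𝒟 : Set W.Div} {m : W.Div → Fin 2 → ℕ} (meetsV : W.Div → W.Div → Prop) (φ : PreWpSet W 𝒟 m) : Prop :=
  IsWpSet W meetsV φ

section Chart

variable {A : Type u} [CommRing A]

/-- **The ℘-centre `Z_ϕ = Y⁺ ∩ Y⁻` on an affine chart** (C43L104–L108 «the scheme-theoretic intersection»): with the chart
ideals of the named divisors given by `divI` (row 106 Prop. 5.11 `plDivAt/rhoDivAt/LDivAt/excDivAt`; row 108 `WpEllChart`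
fields `plDiv/rhoDiv/excDiv`), the sum of the two ideals. PARTITION name `wpCentre`.
[claim: Hu2025, status: under-review]
STATUS: candidate statement under adjudication (D-0012/D-0089); not asserted. -/
def wpCentreIdeal {𝒟 : Set W.Div} {m : W.Div → Fin 2 → ℕ} (divI : W.Div → Ideal A) (φ : PreWpSet W 𝒟 m) : Ideal A :=
  divI φ.plus ⊔ divI φ.minus

/-- **`wpCentre` — lit/PARTITION-HU.md row 107's expected name for the ℘-centre `Z_ϕ = Y⁺ ∩ Y⁻`** (C43L104–L108
«the scheme-theoretic intersection»; p.99) on an affine chart: alias of `wpCentreIdeal` (name concordance only).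
[claim: Hu2025, status: under-review]
STATUS: candidate statement under adjudication (D-0012/D-0089); not asserted. -/
abbrev wpCentre {𝒟 : Set W.Div} {m : W.Div → Fin 2 → ℕ} (divI : W.Div → Ideal A) (φ : PreWpSet W 𝒟 m) : Ideal A :=
  W.wpCentreIdeal divI φ

/-- **Chart reading of the tests «Y ∩ Y' ∩ Ṽ ≠ ∅» (Def. 6.4 C43L112) — OURS READING at the carrier level:** on an affine chart
with coordinate ring `A`, chart ideal `vI` of `Ṽ` and divisor ideals `divI`, the intersection `Y ∩ Y' ∩ Ṽ ∩ 𝔙` is NON-EMPTY iff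
the ideal `divI Y + divI Y' + vI` is proper (a proper ideal of a finitely generated algebra over a field lies in a maximal
ideal = a closed point; standard). Globally: non-empty iff non-empty on SOME (admissible) affine chart. The instantiation of
`meetsV` at scheme level is rows 108/110's; this is the chart-by-chart form.
[claim: Hu2025, status: under-review]
STATUS: candidate statement under adjudication (D-0012/D-0089); not asserted — OURS reading. -/
def meetsOnChart (vI : Ideal A) (divI : W.Div → Ideal A) (Y Y' : W.Div) : Prop :=
  divI Y ⊔ divI Y' ⊔ vI ≠ ⊤

end Chart

/-- **Remark after Def. 6.4 (C43L116–L121; p.99), the claim:** «Recall that due to Corollary (no-(m,u)) [Cor. 5.18], we do not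
associate X_{(m,u_k)} with T⁻_(kτ). Hence Y⁻ ≠ X_{(℘_(kτ)𝔯_{μ−1}),(m,u_k)}.» Typed for the pre-℘-sets over any name set and
any column `m` whose `T⁻`-entry at `X_{(m,u_k)}` vanishes (as Def. 6.1 sets it and Def. 6.6 propagates).
[claim: Hu2025, status: under-review]
STATUS: candidate statement under adjudication (D-0012/D-0089); not asserted. -/
def _root_.Literature.AlgebraicGeometry.Hu2025.Statements.S06WpEllBlowups.C43L118 (W : WpFrame P Λ) (kτ : W.IndexBgov) (𝒟 : Set W.Div) (m : W.Div → Fin 2 → ℕ) : Prop :=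
  m (Div.varrho (W.lead kτ.1)) 1 = 0 → ∀ φ : PreWpSet W 𝒟 m, φ.minus ≠ Div.varrho (W.lead kτ.1)

/-- **C43L123–L133 (p.99), the claim:** «As there are only finitely many ϖ-, ϱ-, and exceptional divisors on the scheme
ℛ̃_{(℘_(kτ)𝔯_{μ−1})}, that is, the set 𝒟_{(℘_(kτ)𝔯_{μ−1})} is finite, one sees that there are only finitely many ℘-sets in
(℘_(kτ)𝔯_μ). We let Φ_{℘_(kτ)𝔯_μ} be the finite set of all ℘-sets in (℘_(kτ)𝔯_μ); we let 𝒵_{℘_(kτ)𝔯_μ} be the finite set of all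
corresponding ℘-centers». Typed: finitely many names ⇒ finitely many (pre-)℘-sets.
[claim: Hu2025, status: under-review]
STATUS: candidate statement under adjudication (D-0012/D-0089); not asserted. -/
def _root_.Literature.AlgebraicGeometry.Hu2025.Statements.S06WpEllBlowups.C43L126 (W : WpFrame P Λ) (𝒟 : Set W.Div) (m : W.Div → Fin 2 → ℕ) (meetsV : W.Div → W.Div → Prop) : Prop :=
  𝒟.Finite → {φ : PreWpSet W 𝒟 m | IsWpSet W meetsV φ}.Finite

/-! ## Def. 6.5 — the orders on `𝒟^±` and on the ℘-sets `Φ_{℘_(kτ)𝔯_μ}` -/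

/-- **Definition 6.5, the order on `𝒟⁺_{(℘_(kτ)𝔯_{μ−1})}` (C43L137–C44L6; p.99).** «Let 𝒟^±_{(℘_(kτ)𝔯_{μ−1})} be the set of all
divisors associated with T^±_(kτ). We order the set 𝒟⁺ as follows. We let X_{(℘_(kτ)𝔯_{μ−1}),(u_s,v_s)} be the largest and
X_{(℘_(kτ)𝔯_{μ−1}),u_k} be the second largest. The rest are exceptional divisors. We order them by reversing the order of
occurrence of the exceptional divisors.» Typed as the strict relation `Y < Y'` on names for the binomial `(kτ)` (the claim
«the rest are exceptional» is part of `C44L6`): every name other than `X_{(u_s,v_s)}` is below it; every name other than those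
two is below `X_{u_k}`; two exceptional names compare by REVERSED occurrence.
[claim: Hu2025, status: under-review]
STATUS: candidate statement under adjudication (D-0012/D-0089); not asserted. -/
def Def6_5_plusLT (kτ : W.IndexBgov) (Y Y' : W.Div) : Prop :=
  (Y' = Div.varrho (W.termR kτ.1 kτ.2) ∧ Y ≠ Y') ∨
  (Y' = Div.varpi (W.ult kτ.1) ∧ Y ≠ Y' ∧ Y ≠ Div.varrho (W.termR kτ.1 kτ.2)) ∨
  (Y.IsExceptional ∧ Y'.IsExceptional ∧ Div.OccLT Y' Y)

/-- **Definition 6.5, the order on `𝒟⁻_{(℘_(kτ)𝔯_{μ−1})}` (C44L8–L20; p.99).** «We let 𝒟⁻_{…,ϖ} be the subset of ϖ-divisors with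
the order induced from that on the set of all Plücker-variables. We let ℰ⁻ be the subset of exceptional divisors by reversing
the order of occurrence. We then declare ℰ⁻ < 𝒟⁻_{…,ϖ}.» The order on the Plücker variables (Def. 3.14 / 3.15, row 102;
C44L12 «$\pl$-variables» = PDF p.99 l.43 «Plücker-variables») is the parameter `ltP`. (ϱ-divisors are never associated with `T⁻` by Def. 6.1/6.6 — they do not occur here.)
[claim: Hu2025, status: under-review]
STATUS: candidate statement under adjudication (D-0012/D-0089); not asserted. -/
def Def6_5_minusLT (ltP : P → P → Prop) (Y Y' : W.Div) : Prop :=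
  (Y.IsExceptional ∧ Y'.IsExceptional ∧ Div.OccLT Y' Y) ∨
  (Y.IsExceptional ∧ Y'.IsVarpi) ∨
  (∃ u u' : P, Y = Div.varpi u ∧ Y' = Div.varpi u' ∧ ltP u u')

/-- **Definition 6.5, the order on the ℘-sets (C44L22–L26; p.100).** «Now, let ϕ₁, ϕ₂ ∈ Φ_{℘_(kτ)𝔯_μ} be any two distinct
elements. Write ϕ = {Y_i⁺, Y_i⁻}, i = 1, 2. We [say] ϕ₁ < ϕ₂ if Y₁⁺ < Y₂⁺ or Y₁⁺ = Y₂⁺ and Y₁⁻ < Y₂⁻. This endows Φ_{℘_(kτ)𝔯_μ} a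
total order "<".» PARTITION name `Def6_5`.
[claim: Hu2025, status: under-review]
STATUS: candidate statement under adjudication (D-0012/D-0089); not asserted. -/
def Def6_5_phiLT (ltP : P → P → Prop) (kτ : W.IndexBgov) {𝒟 : Set W.Div} {m : W.Div → Fin 2 → ℕ}
    (φ₁ φ₂ : PreWpSet W 𝒟 m) : Prop :=
  W.Def6_5_plusLT kτ φ₁.plus φ₂.plus ∨ (φ₁.plus = φ₂.plus ∧ W.Def6_5_minusLT ltP φ₁.minus φ₂.minus)

/-- **Definition 6.5 under its printed name:** the order on the ℘-sets of `(℘_(kτ)𝔯_μ)`. Alias of `Def6_5_phiLT`.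
[claim: Hu2025, status: under-review]
STATUS: candidate statement under adjudication (D-0012/D-0089); not asserted. -/
abbrev _root_.Literature.AlgebraicGeometry.Hu2025.Statements.S06WpEllBlowups.Def6_5 (W : WpFrame P Λ) (ltP : P → P → Prop) (kτ : W.IndexBgov) {𝒟 : Set W.Div} {m : W.Div → Fin 2 → ℕ}
    (φ₁ φ₂ : PreWpSet W 𝒟 m) : Prop :=
  W.Def6_5_phiLT ltP kτ φ₁ φ₂

/-- **C44L1–L6 (p.99), the claim «The rest are exceptional divisors. … By Definition (p-t) [PDF: Definition 3.15],
𝒟⁺_{(℘_(kτ)𝔯_{μ−1})} is totally ordered»:** on the names of `𝒟` associated with `T⁺_(kτ)`, every member other than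
`X_{(u_s,v_s)}`, `X_{u_k}` is exceptional, and `Def6_5_plusLT` is trichotomous.
[claim: Hu2025, status: under-review]
STATUS: candidate statement under adjudication (D-0012/D-0089); not asserted. -/
def _root_.Literature.AlgebraicGeometry.Hu2025.Statements.S06WpEllBlowups.C44L6 (W : WpFrame P Λ) (kτ : W.IndexBgov) (𝒟 : Set W.Div) (m : W.Div → Fin 2 → ℕ) : Prop :=
  (∀ Y ∈ 𝒟, IsAssociated (m Y 0) →
    Y = Div.varrho (W.termR kτ.1 kτ.2) ∨ Y = Div.varpi (W.ult kτ.1) ∨ Y.IsExceptional) ∧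
  (∀ Y ∈ 𝒟, ∀ Y' ∈ 𝒟, IsAssociated (m Y 0) → IsAssociated (m Y' 0) → Y ≠ Y' →
    (W.Def6_5_plusLT kτ Y Y' ∨ W.Def6_5_plusLT kτ Y' Y))

/-- **C44L20 (p.99), the claim «By Definition (p-t) [PDF: Definition 3.15], 𝒟⁻_{(℘_(kτ)𝔯_{μ−1})} is totally ordered»:** on the
names of `𝒟` associated with `T⁻_(kτ)`, every member is a ϖ-divisor or exceptional, and `Def6_5_minusLT` is trichotomous
(given the order `ltP` on the Plücker variables).
[claim: Hu2025, status: under-review]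
STATUS: candidate statement under adjudication (D-0012/D-0089); not asserted. -/
def _root_.Literature.AlgebraicGeometry.Hu2025.Statements.S06WpEllBlowups.C44L20 (W : WpFrame P Λ) (ltP : P → P → Prop) (𝒟 : Set W.Div) (m : W.Div → Fin 2 → ℕ) : Prop :=
  (∀ Y ∈ 𝒟, IsAssociated (m Y 1) → Y.IsVarpi ∨ Y.IsExceptional) ∧
  (∀ Y ∈ 𝒟, ∀ Y' ∈ 𝒟, IsAssociated (m Y 1) → IsAssociated (m Y' 1) → Y ≠ Y' →
    (W.Def6_5_minusLT ltP Y Y' ∨ W.Def6_5_minusLT ltP Y' Y))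

/-- **The ordered list of the ℘-sets of the round (C44L28–L38; p.100):** «Thus, we can list Φ_{℘_(kτ)𝔯_μ} as Φ_{℘_(kτ)𝔯_μ} =
{ϕ_(kτ)μ1 < ⋯ < ϕ_(kτ)μσ_(kτ)μ} for some finite positive integer σ_(kτ)μ depending on (kτ)μ. We then let the set 𝒵_{℘_(kτ)𝔯_μ} of
the corresponding ℘-centers inherit the total order from that of Φ_{℘_(kτ)𝔯_μ}.» Typed: `L` lists every ℘-set exactly once,
increasingly for Def. 6.5's order; `σ_(kτ)μ = L.length` and `ϕ_(kτ)μh = L[h−1]`.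
[claim: Hu2025, status: under-review]
STATUS: candidate statement under adjudication (D-0012/D-0089); not asserted. -/
def IsPhiListing (ltP : P → P → Prop) (kτ : W.IndexBgov) {𝒟 : Set W.Div} {m : W.Div → Fin 2 → ℕ}
    (meetsV : W.Div → W.Div → Prop) (L : List (PreWpSet W 𝒟 m)) : Prop :=
  (∀ φ : PreWpSet W 𝒟 m, IsWpSet W meetsV φ ↔ ∃ ψ ∈ L, ψ.plus = φ.plus ∧ ψ.minus = φ.minus) ∧
  L.Pairwise fun φ₁ φ₂ => W.Def6_5_phiLT ltP kτ φ₁ φ₂ ∧ ¬ (φ₁.plus = φ₂.plus ∧ φ₁.minus = φ₂.minus)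

end WpFrame

end Literature.AlgebraicGeometry.Hu2025.Statements.S06WpEllBlowups

end
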